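import Literature.NumberTheory.Sieve.FGKMT2018CoveringMoments
import HarnessLib

/-!
# Ford–Green–Konyagin–Maynard–Tao 2018 — §6: bridges between the box-format engines and the data of
# Theorems 4′/5 (PROVED)

Topic `Literature/NumberTheory/Sieve`. Source: K. Ford, B. Green, S. Konyagin, J. Maynard, T. Tao,
*Long gaps between primes*, J. Amer. Math. Soc. 31 (2018) 65–105 = arXiv:1412.5029, §6 pp. 17–19
[FordGreenKonyaginMaynardTao2018]. In the deduction of Theorem 4 from Theorem 5 (pp. 17–19) the
vector `a⃗ = (a_s mod s)_{s ∈ 𝒮}` is uniform on the finite box `∏_{s ∈ 𝒮} ℤ/sℤ`; the engines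
`FGKMT2018BoxMoments` (Cor 4), `FGKMT2018GoodPrimes` (Lemma 6.3), `FGKMT2018CoveringMoments`
(Lemma 6.2) are written over that box (`residueBox 𝒮`, `extendRes`). This file PROVES the identities
linking them to the objects of Theorem 4′ (`sievedQ`, `primesQ`, `primesHalf`, `weightWindow`) and
to the hypotheses (6.3), (6.4) of Theorem 5:
* `mem_sievedQ_extendRes`, `siftInd_singleton_eq_one_of_mem`, `card_sievedQ_eq_siftedCard`,
  `boxExp_card_sievedQ` — `𝒬 ∩ S(a⃗)` in box format and `E #(𝒬 ∩ S(a⃗)) = σ #𝒬` (for (4.5′));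
* `Alaw_lawTilde_approx` — (6.3) + (6.4) ⟹ `A_q = Σ_i Σ_p P(ñ_p = q − h_i p) = (1 + O_≤(3ε₁)) r E/D`
  (`= (1 + O(log₂^{-10} x)) u x/(2y)`, the main term of Lemma 6.2);
* `le_of_mem_primesHalf`, `abs_le_of_mem_weightWindow`, `abs_sub_le_of_mem_pairSet`,
  `abs_sub_le_of_mem_shiftSet` — the diameter bounds `M` fed to Lemma 6.1 (`log M ≪ log x`).
-/

noncomputable section

open Finset

namespace Literature.NumberTheory.Sieve

namespace FGKMT2018

/-! ### `𝒬 ∩ S(a⃗)` in box format -/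

/-- `q ∈ 𝒬 ∩ S(a⃗)` for `a⃗ = extendRes 𝒮 f` iff `q ∈ 𝒬` and `q ≢ f(s) (mod s)` for all `s ∈ 𝒮`
(integer congruences). [cite: FordGreenKonyaginMaynardTao2018, Thm 4 p. 13] -/
theorem mem_sievedQ_extendRes {c : ℝ} {x : ℕ} (f : (s : ℕ) → s ∈ primesS x → ℕ) {q : ℕ} :
    q ∈ sievedQ c x (extendRes (primesS x) f) ↔
      q ∈ primesQ c x ∧ ∀ s (h : s ∈ primesS x), ¬ (q : ℤ) ≡ (f s h : ℤ) [ZMOD (s : ℤ)] := by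
  unfold sievedQ
  rw [Finset.mem_filter]
  refine and_congr_right fun _ => ?_
  constructor
  · intro hall s hs hmod
    refine hall s hs ?_
    rw [extendRes_apply f hs]
    exact Int.natCast_modEq_iff.1 hmod
  · intro hall s hs hmod
    refine hall s hs ?_
    rw [extendRes_apply f hs] at hmod
    exact Int.natCast_modEq_iff.2 hmod

/-- For `q ∈ 𝒬 ∩ S(a⃗)`: `1_{q ∈ S(a⃗)} = 1` in box format.
[cite: FordGreenKonyaginMaynardTao2018, Thm 4 p. 13] -/
theorem siftInd_singleton_eq_one_of_mem {c : ℝ} {x : ℕ} (f : (s : ℕ) → s ∈ primesS x → ℕ)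
    {q : ℕ} (hq : q ∈ sievedQ c x (extendRes (primesS x) f)) :
    siftInd (primesS x) {(q : ℤ)} f = 1 :=
  (siftInd_singleton_eq_one_iff f (q : ℤ)).2 ((mem_sievedQ_extendRes f).1 hq).2

/-- `#(𝒬 ∩ S(a⃗)) = siftedCard 𝒮 f 𝒬` (with `𝒬` viewed in `ℤ`).
[cite: FordGreenKonyaginMaynardTao2018, (4.5) p. 13] -/
theorem card_sievedQ_eq_siftedCard {c : ℝ} {x : ℕ} (f : (s : ℕ) → s ∈ primesS x → ℕ) :
    #(sievedQ c x (extendRes (primesS x) f)) =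
      siftedCard (primesS x) f ((primesQ c x).image (Nat.cast : ℕ → ℤ)) := by
  classical
  unfold siftedCard
  rw [Finset.filter_image, Finset.card_image_of_injective _ Nat.cast_injective]
  congr 1
  ext q
  rw [mem_sievedQ_extendRes, Finset.mem_filter]

/-- **`E #(𝒬 ∩ S(a⃗)) = σ #𝒬`** over the uniform `a⃗` (the first moment behind (4.5′), cf. Cor 4).
[cite: FordGreenKonyaginMaynardTao2018, Cor 4 p. 18] -/
theorem boxExp_card_sievedQ {c : ℝ} {x : ℕ} (hS : ∀ s ∈ primesS x, 0 < s) :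
    boxExp (primesS x) (fun f => (#(sievedQ c x (extendRes (primesS x) f)) : ℝ)) =
      sigmaProd (primesS x) * #(primesQ c x) := by
  classical
  have h := boxExp_siftedCard_eq hS ((primesQ c x).image (Nat.cast : ℕ → ℤ))
  rw [Finset.card_image_of_injective _ Nat.cast_injective] at h
  have hfun : (fun f : (s : ℕ) → s ∈ primesS x → ℕ =>
      (#(sievedQ c x (extendRes (primesS x) f)) : ℝ)) =
      fun f => (siftedCard (primesS x) f ((primesQ c x).image (Nat.cast : ℕ → ℤ)) : ℝ) := by
    funext f
    rw [card_sievedQ_eq_siftedCard]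
  rw [hfun, h]
  rfl

/-- **Markov for (4.5′)**: `#{a⃗ : #(𝒬 ∩ S(a⃗)) ≥ t} ≤ σ #𝒬/t · ∏ s`.
[cite: FordGreenKonyaginMaynardTao2018, (4.5) and Cor 4 p. 18] -/
theorem card_box_sievedQ_ge_le {c : ℝ} {x : ℕ} (hS : ∀ s ∈ primesS x, 0 < s) {t : ℝ} (ht : 0 < t) :
    (#((residueBox (primesS x)).filter fun f =>
        t ≤ (#(sievedQ c x (extendRes (primesS x) f)) : ℝ)) : ℝ) ≤
      sigmaProd (primesS x) * #(primesQ c x) / t * ∏ s ∈ primesS x, (s : ℝ) := by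
  rw [← boxExp_card_sievedQ hS]
  exact card_box_filter_le hS _ (fun f _ => Nat.cast_nonneg _) ht

/-! ### (6.3) + (6.4) ⟹ the main term `A_q` of Lemma 6.2 -/

/-- **`A_q = (1 + O_≤(3ε₁)) r E/D`** from (6.3) `Σ_n w(p, n) = (1 + O_≤(ε₁)) D` (`p ∈ 𝒫`) and (6.4)
`Σ_{p ∈ 𝒫} w(p, q − hp) = (1 + O_≤(ε₁)) E` (`h ∈ H`), for `0 ≤ ε₁ ≤ 1/3`; in §6, `D = τy/log^r x`,
`E = τ (u/r) x/(2 log^r x)`, so `r E/D = u x/(2y)` and `σ^{r−1} · rE/D = σ^{r−1} u x/(2y)` is the mean in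
Lemma 6.2. [cite: FordGreenKonyaginMaynardTao2018, (6.3)–(6.4) p. 17, Lemma 6.2 (proof) p. 19] -/
theorem Alaw_lawTilde_approx {P : Finset ℕ} {H : Finset ℤ} {w : ℕ → ℤ → ℝ} {N : Finset ℤ} {q : ℤ}
    {D E ε₁ : ℝ} (hD : 0 < D) (hE : 0 ≤ E) (hε : 0 ≤ ε₁) (hε3 : ε₁ ≤ 1 / 3)
    (hw : ∀ p n, 0 ≤ w p n) (h63 : ∀ p ∈ P, |∑ n ∈ N, w p n - D| ≤ ε₁ * D)
    (h64 : ∀ h ∈ H, |∑ p ∈ P, w p (q - h * (p : ℤ)) - E| ≤ ε₁ * E) :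
    |Alaw P H (fun p n => lawTilde w N p n) q - #H * (E / D)| ≤ 3 * ε₁ * (#H * (E / D)) := by
  rw [Alaw_eq_sum]
  have h1ε : 0 < 1 - ε₁ := by linarith
  have h1ε' : 0 < 1 + ε₁ := by linarith
  -- per h: the inner sum is squeezed
  have hinner : ∀ h ∈ H,
      (1 - ε₁) * E / ((1 + ε₁) * D) ≤ ∑ p ∈ P, lawTilde w N p (q - h * (p : ℤ)) ∧
      ∑ p ∈ P, lawTilde w N p (q - h * (p : ℤ)) ≤ (1 + ε₁) * E / ((1 - ε₁) * D) := by
    intro h hh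
    have hEh := h64 h hh
    rw [abs_le] at hEh
    have hterm : ∀ p ∈ P, w p (q - h * (p : ℤ)) / ((1 + ε₁) * D) ≤ lawTilde w N p (q - h * (p : ℤ)) ∧
        lawTilde w N p (q - h * (p : ℤ)) ≤ w p (q - h * (p : ℤ)) / ((1 - ε₁) * D) := by
      intro p hp
      have hDp := h63 p hp
      rw [abs_le] at hDp
      have hlo : (1 - ε₁) * D ≤ ∑ n ∈ N, w p n := by linarith
      have hhi : ∑ n ∈ N, w p n ≤ (1 + ε₁) * D := by linarith
      have hpos : 0 < ∑ n ∈ N, w p n := lt_of_lt_of_le (mul_pos h1ε hD) hlo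
      unfold lawTilde
      exact ⟨div_le_div_of_nonneg_left (hw _ _) hpos hhi,
        div_le_div_of_nonneg_left (hw _ _) (mul_pos h1ε hD) hlo⟩
    constructor
    · calc (1 - ε₁) * E / ((1 + ε₁) * D) ≤ (∑ p ∈ P, w p (q - h * (p : ℤ))) / ((1 + ε₁) * D) :=
            div_le_div_of_nonneg_right (by linarith) (mul_pos h1ε' hD).le
        _ = ∑ p ∈ P, w p (q - h * (p : ℤ)) / ((1 + ε₁) * D) := Finset.sum_div _ _ _
        _ ≤ _ := Finset.sum_le_sum fun p hp => (hterm p hp).1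
    · calc ∑ p ∈ P, lawTilde w N p (q - h * (p : ℤ))
            ≤ ∑ p ∈ P, w p (q - h * (p : ℤ)) / ((1 - ε₁) * D) :=
            Finset.sum_le_sum fun p hp => (hterm p hp).2
        _ = (∑ p ∈ P, w p (q - h * (p : ℤ))) / ((1 - ε₁) * D) := (Finset.sum_div _ _ _).symm
        _ ≤ (1 + ε₁) * E / ((1 - ε₁) * D) :=
            div_le_div_of_nonneg_right (by linarith) (mul_pos h1ε hD).le
  -- sum over h
  have hlo : (#H : ℝ) * ((1 - ε₁) * E / ((1 + ε₁) * D)) ≤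
      ∑ h ∈ H, ∑ p ∈ P, lawTilde w N p (q - h * (p : ℤ)) := by
    rw [← nsmul_eq_mul, ← Finset.sum_const]
    exact Finset.sum_le_sum fun h hh => (hinner h hh).1
  have hhi : ∑ h ∈ H, ∑ p ∈ P, lawTilde w N p (q - h * (p : ℤ)) ≤
      (#H : ℝ) * ((1 + ε₁) * E / ((1 - ε₁) * D)) := by
    rw [← nsmul_eq_mul, ← Finset.sum_const]
    exact Finset.sum_le_sum fun h hh => (hinner h hh).2
  -- elementary: (1+ε)/(1-ε) ≤ 1+3ε and (1-ε)/(1+ε) ≥ 1-3ε for 0 ≤ ε ≤ 1/3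
  have hED : 0 ≤ E / D := div_nonneg hE hD.le
  have hr0 : (0 : ℝ) ≤ #H := Nat.cast_nonneg _
  have hup : (1 + ε₁) * E / ((1 - ε₁) * D) ≤ (1 + 3 * ε₁) * (E / D) := by
    rw [div_le_iff₀ (mul_pos h1ε hD)]
    have : (1 + 3 * ε₁) * (E / D) * ((1 - ε₁) * D) = (1 + 3 * ε₁) * (1 - ε₁) * E := by
      field_simp
    rw [this]
    have h13 : 0 ≤ 1 - 3 * ε₁ := by linarith
    nlinarith [mul_nonneg (mul_nonneg hε h13) hE]
  have hdown : (1 - 3 * ε₁) * (E / D) ≤ (1 - ε₁) * E / ((1 + ε₁) * D) := by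
    rw [le_div_iff₀ (mul_pos h1ε' hD)]
    have : (1 - 3 * ε₁) * (E / D) * ((1 + ε₁) * D) = (1 - 3 * ε₁) * (1 + ε₁) * E := by
      field_simp
    rw [this]
    nlinarith [mul_nonneg hε hE, mul_nonneg (mul_nonneg hε hε) hE]
  have hup' := mul_le_mul_of_nonneg_left hup hr0
  have hdown' := mul_le_mul_of_nonneg_left hdown hr0
  rw [abs_le]
  constructor <;> nlinarith

/-! ### Sizes and diameters -/

/-- `p ∈ 𝒫 ⟹ p ≤ x`. [cite: FordGreenKonyaginMaynardTao2018, (3.4)] -/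
theorem le_of_mem_primesHalf {x p : ℕ} (hp : p ∈ primesHalf x) : p ≤ x := by
  unfold primesHalf at hp
  rw [Finset.mem_filter, Finset.mem_Icc] at hp
  exact hp.1.2

/-- `p ∈ 𝒫 ⟹ p` prime and `x < 2p`. [cite: FordGreenKonyaginMaynardTao2018, (3.4)] -/
theorem prime_of_mem_primesHalf {x p : ℕ} (hp : p ∈ primesHalf x) : p.Prime ∧ x < 2 * p := by
  unfold primesHalf at hp
  rw [Finset.mem_filter] at hp
  exact hp.2

/-- `q ∈ 𝒬 ⟹ x < q ≤ y`. [cite: FordGreenKonyaginMaynardTao2018, (3.5)] -/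
theorem bounds_of_mem_primesQ {c : ℝ} {x q : ℕ} (hq : q ∈ primesQ c x) :
    q.Prime ∧ x < q ∧ (q : ℝ) ≤ ySieve c x := by
  unfold primesQ at hq
  rw [Finset.mem_filter, Finset.mem_Icc] at hq
  refine ⟨hq.2, by omega, ?_⟩
  have hy : q ≤ ⌊ySieve c x⌋₊ := hq.1.2
  rcases lt_or_ge (ySieve c x) 0 with hneg | hnn
  · rw [Nat.floor_of_nonpos hneg.le] at hy
    have := hq.2.pos
    omega
  · exact le_trans (by exact_mod_cast hy) (Nat.floor_le hnn)

/-- `n ∈ [−⌊y⌋, ⌊y⌋] ⟹ |n| ≤ y` (for `y ≥ 0`). [cite: FordGreenKonyaginMaynardTao2018, Thm 5 p. 17] -/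
theorem abs_le_of_mem_weightWindow {c : ℝ} {x : ℕ} (hy : 0 ≤ ySieve c x) {n : ℤ}
    (hn : n ∈ weightWindow c x) : (|n| : ℝ) ≤ ySieve c x := by
  unfold weightWindow at hn
  rw [Finset.mem_Icc] at hn
  have h1 : (|n| : ℝ) ≤ (⌊ySieve c x⌋₊ : ℝ) := by
    have : |n| ≤ (⌊ySieve c x⌋₊ : ℤ) := abs_le.2 ⟨hn.1, hn.2⟩
    exact_mod_cast this
  exact h1.trans (Nat.floor_le hy)

/-- Diameter of the union of two pair sets at `q` (hypothesis `hM` of `FGKMT2018CoveringMoments`):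
`|m − m'| ≤ 2Bx` when `|h − h'| ≤ B` on `H` and the primes are `≤ x`.
[cite: FordGreenKonyaginMaynardTao2018, Lemma 6.2 (proof) p. 19] -/
theorem abs_sub_le_of_mem_pairSet {x : ℕ} {H : Finset ℤ} {B : ℤ}
    (hH : ∀ h ∈ H, ∀ h' ∈ H, |h' - h| ≤ B) {q : ℤ} {i j : ℤ × ℕ}
    (hi : i ∈ H ×ˢ primesHalf x) (hj : j ∈ H ×ˢ primesHalf x) {m m' : ℤ}
    (hm : m ∈ pairSet H q i) (hm' : m' ∈ pairSet H q j) :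
    (|m - m'| : ℝ) ≤ 2 * (B : ℝ) * x := by
  rw [Finset.mem_product] at hi hj
  obtain ⟨h₁, hh₁, rfl⟩ := mem_shiftSet.1 hm
  obtain ⟨h₂, hh₂, rfl⟩ := mem_shiftSet.1 hm'
  have hB0 : 0 ≤ B := le_trans (abs_nonneg _) (hH i.1 hi.1 i.1 hi.1)
  have hp₁ : (i.2 : ℤ) ≤ x := by exact_mod_cast le_of_mem_primesHalf hi.2
  have hp₂ : (j.2 : ℤ) ≤ x := by exact_mod_cast le_of_mem_primesHalf hj.2
  have hint : |(q - i.1 * (i.2 : ℤ) + h₁ * (i.2 : ℤ)) - (q - j.1 * (j.2 : ℤ) + h₂ * (j.2 : ℤ))|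
      ≤ 2 * B * x := by
    have e : (q - i.1 * (i.2 : ℤ) + h₁ * (i.2 : ℤ)) - (q - j.1 * (j.2 : ℤ) + h₂ * (j.2 : ℤ)) =
        (h₁ - i.1) * (i.2 : ℤ) - (h₂ - j.1) * (j.2 : ℤ) := by ring
    rw [e]
    refine (abs_sub _ _).trans ?_
    rw [abs_mul, abs_mul, abs_of_nonneg (by positivity : (0 : ℤ) ≤ i.2),
      abs_of_nonneg (by positivity : (0 : ℤ) ≤ j.2)]
    have a₁ := hH i.1 hi.1 h₁ hh₁
    have a₂ := hH j.1 hj.1 h₂ hh₂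
    nlinarith [abs_nonneg (h₁ - i.1), abs_nonneg (h₂ - j.1)]
  have := (Int.cast_le (R := ℝ)).2 hint
  push_cast at this ⊢
  exact this

/-- Diameter of a shift set `{n + hp}` over the weight window (hypothesis `hM` of
`FGKMT2018GoodPrimes`): `|(n + hp) − (n' + h'p)| ≤ 2y + Bx`.
[cite: FordGreenKonyaginMaynardTao2018, Lemma 6.3 (proof) p. 18] -/
theorem abs_sub_le_of_mem_shiftSet {c : ℝ} {x : ℕ} (hy : 0 ≤ ySieve c x) {H : Finset ℤ} {B : ℤ}
    (hH : ∀ h ∈ H, ∀ h' ∈ H, |h' - h| ≤ B) {p : ℕ} (hp : p ∈ primesHalf x)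
    {n n' : ℤ} (hn : n ∈ weightWindow c x) (hn' : n' ∈ weightWindow c x)
    {h h' : ℤ} (hh : h ∈ H) (hh' : h' ∈ H) :
    |(((n + h * (p : ℤ) : ℤ)) : ℝ) - ((n' + h' * (p : ℤ) : ℤ) : ℝ)| ≤
      2 * ySieve c x + (B : ℝ) * x := by
  have hpx : (p : ℝ) ≤ x := by exact_mod_cast le_of_mem_primesHalf hp
  have hB : (|h - h'| : ℝ) ≤ B := by
    have := hH h' hh' h hh
    exact_mod_cast this
  have hn1 := abs_le_of_mem_weightWindow hy hn
  have hn2 := abs_le_of_mem_weightWindow hy hn'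
  push_cast
  have e : ((n : ℝ) + h * p) - (n' + h' * p) = (n - n') + (h - h') * p := by ring
  rw [e]
  refine (abs_add_le _ _).trans ?_
  rw [abs_mul, Nat.abs_cast]
  have h3 : |(n : ℝ) - n'| ≤ 2 * ySieve c x := (abs_sub _ _).trans (by linarith)
  have h4 : |(h : ℝ) - h'| * p ≤ B * x :=
    mul_le_mul hB hpx (Nat.cast_nonneg p) ((abs_nonneg _).trans hB)
  linarith

end FGKMT2018

end Literature.NumberTheory.Sieve
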